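import Summits.QuantumAdvantage.QuantumAdvantage.Theorems.SymplecticPurityDeqThesisHLikeLemmas

/-!
# Crux `DeqThesis` (stmt-QuantumAdvantage-0242), line `Sketch` — stub `stub_hlikeFlat` (regime K4c), estimate

The row-Fourier estimate assembled from `SymplecticPurityDeqThesisHLikeLemmas.lean` (character expansion of
product functions, the inner column sum against the cube with its doubly-zero frequency removed, and the
one-site facts for `M = vσ_Qv†`): `|⟨ĝ| ⊗ₖ uₖσ_{Sₖ}uₖ† |ĝ⟩| ≤ 2√2ⁿ ∏_{k<2n} μₖ + 2^{-n}(2√2ⁿ + 1)`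
(`norm_graph_dot_le_hlike`), the final arithmetic, and the registered stub `stub_hlikeFlat`
(`∏ₖ μₖ ≤ 2^{-5n/8}`, `n ≥ 48` ⇒ `≤ 2^{-n/16}`).
-/

set_option linter.dupNamespace false -- D-0017: single-problem summit ⇒ `QuantumAdvantage.QuantumAdvantage` by design

noncomputable section

namespace Summit.QuantumAdvantage.QuantumAdvantage.Theorems.SymplecticPurity

open Matrix Finset Literature.Computability.QuantumComplexity Literature.Computability.Cryptography

namespace HLike

/-! ### The estimate -/

/-- **Main estimate, row-Fourier form.** For the weighted cube graph vector `g = c Σ_x |x⟩|F x⟩` and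
`O = ⊗ₖ Mₖ`, `Mₖ = uₖ σ_{Sₖ} uₖ†`:
`|⟨g|O|g⟩| ≤ |c|² (2ⁿ · 2√2ⁿ · ∏ₖ μₖ + 2√2ⁿ + 1)`, `μₖ = ½(‖Mₖ(0,0)+Mₖ(0,1)‖ + ‖Mₖ(0,0)−Mₖ(0,1)‖)`. -/
theorem norm_graph_dot_le_hlike {n : ℕ} {K : Type*} [Field K] [Fintype K] (hK : Fintype.card K = 2 ^ n)
    (e : K ≃+ (Fin n → ZMod 2)) (u : Fin (n + n) → Matrix Bool Bool ℂ)
    (hu : ∀ i, u i ∈ Matrix.unitaryGroup Bool ℂ) (S : Fin (n + n) → Pauli) (F : QReg n → QReg n)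
    (hF : ∀ x j, F x j = decide (e ((e.symm fun i : Fin n => if x i then 1 else 0) ^ 3) j = 1))
    (c : ℂ) :
    ‖star (fun w : QReg (n + n) =>
        if (fun j : Fin n => w (Fin.natAdd n j)) = F (fun i : Fin n => w (Fin.castAdd n i))
        then c else 0) ⬝ᵥ
      (tensorAll (fun i => u i * (S i).mat * star (u i))).mulVec (fun w : QReg (n + n) =>
        if (fun j : Fin n => w (Fin.natAdd n j)) = F (fun i : Fin n => w (Fin.castAdd n i))
        then c else 0)‖ ≤
    ‖c‖ ^ 2 * ((2 : ℝ) ^ n * (2 * Real.sqrt 2 ^ n) *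
        ∏ k : Fin (n + n), ((‖(u k * (S k).mat * star (u k)) false false + (u k * (S k).mat * star (u k)) false true‖ +
          ‖(u k * (S k).mat * star (u k)) false false - (u k * (S k).mat * star (u k)) false true‖) / 2) +
        (2 * Real.sqrt 2 ^ n + 1)) := by
  classical
  obtain ⟨M, hM⟩ : ∃ M : Fin (n + n) → Matrix Bool Bool ℂ, M = fun k => u k * (S k).mat * star (u k) :=
    ⟨_, rfl⟩
  rw [show (fun i => u i * (S i).mat * star (u i)) = M from hM.symm]
  simp_rw [show ∀ k, u k * (S k).mat * star (u k) = M k from fun k => by rw [hM]]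
  have hrow : ∀ k b, (‖M k b false + M k b true‖ + ‖M k b false - M k b true‖) / 2 =
      (‖M k false false + M k false true‖ + ‖M k false false - M k false true‖) / 2 := by
    intro k b; cases b
    · rfl
    · rw [hM]; exact rowMass_true_eq (hu k) (S k)
  -- half row sums
  set r : Fin (n + n) → Bool → ℂ := fun k b => (M k b false + M k b true) / 2 with hr
  have hhalf : ∀ k, (‖r k false + r k true‖ + ‖r k false - r k true‖) / 2 ≤ Real.sqrt 2 / 2 := by
    intro k; simp only [hr]; rw [hM]; exact halfRow_mass_le (hu k) (S k)
  have hquart : ∀ k, ‖(r k false + r k true) / 2‖ ≤ 1 / 2 := by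
    intro k; simp only [hr]; rw [hM]; exact quarterSum_norm_le (hu k) (S k)
  rw [OneSided.graph_dot_tensorAll_mulVec F M c _ rfl, norm_mul, norm_mul, norm_star, ← sq]
  refine mul_le_mul_of_nonneg_left ?_ (sq_nonneg _)
  -- each row `x`: inner sum minus its zero-frequency part
  have hin : ∀ x : QReg n,
      ‖(∑ x' : QReg n, (∏ i : Fin n, M (Fin.castAdd n i) (x i) (x' i)) *
          ∏ j : Fin n, M (Fin.natAdd n j) (F x j) (F x' j)) -
          ((∏ i : Fin n, r (Fin.castAdd n i) (x i)) * ∏ j : Fin n, r (Fin.natAdd n j) (F x j)) * (2 : ℂ) ^ n‖ ≤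
        (∏ i : Fin n, ((‖M (Fin.castAdd n i) false false + M (Fin.castAdd n i) false true‖ + ‖M (Fin.castAdd n i) false false - M (Fin.castAdd n i) false true‖) / 2)) *
          (∏ j : Fin n, ((‖M (Fin.natAdd n j) false false + M (Fin.natAdd n j) false true‖ + ‖M (Fin.natAdd n j) false false - M (Fin.natAdd n j) false true‖) / 2)) * (2 * Real.sqrt 2 ^ n) := by
    intro x
    have h := norm_inner_sub_le hK e F hF (fun i b => M (Fin.castAdd n i) (x i) b)
      (fun j b => M (Fin.natAdd n j) (F x j) b)
    have e1 : ∏ i : Fin n, ((‖M (Fin.castAdd n i) (x i) false + M (Fin.castAdd n i) (x i) true‖ +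
        ‖M (Fin.castAdd n i) (x i) false - M (Fin.castAdd n i) (x i) true‖) / 2) =
        ∏ i : Fin n, ((‖M (Fin.castAdd n i) false false + M (Fin.castAdd n i) false true‖ + ‖M (Fin.castAdd n i) false false - M (Fin.castAdd n i) false true‖) / 2) :=
      Finset.prod_congr rfl fun i _ => hrow _ _
    have e2 : ∏ j : Fin n, ((‖M (Fin.natAdd n j) (F x j) false + M (Fin.natAdd n j) (F x j) true‖ +
        ‖M (Fin.natAdd n j) (F x j) false - M (Fin.natAdd n j) (F x j) true‖) / 2) =
        ∏ j : Fin n, ((‖M (Fin.natAdd n j) false false + M (Fin.natAdd n j) false true‖ + ‖M (Fin.natAdd n j) false false - M (Fin.natAdd n j) false true‖) / 2) :=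
      Finset.prod_congr rfl fun j _ => hrow _ _
    rw [e1, e2] at h
    exact h
  -- the zero-frequency rows form a sum of the same shape with the half row sums `r`
  have hzero : ‖∑ x : QReg n, (∏ i : Fin n, r (Fin.castAdd n i) (x i)) * ∏ j : Fin n, r (Fin.natAdd n j) (F x j)‖ ≤
      ((2 : ℝ) ^ n)⁻¹ * (2 * Real.sqrt 2 ^ n) + ((2 : ℝ) ^ n)⁻¹ := by
    have h := norm_inner_sub_le hK e F hF (fun i b => r (Fin.castAdd n i) b) (fun j b => r (Fin.natAdd n j) b)
    have hmain : (∏ i : Fin n, ((‖r (Fin.castAdd n i) false + r (Fin.castAdd n i) true‖ +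
          ‖r (Fin.castAdd n i) false - r (Fin.castAdd n i) true‖) / 2)) *
        (∏ j : Fin n, ((‖r (Fin.natAdd n j) false + r (Fin.natAdd n j) true‖ +
          ‖r (Fin.natAdd n j) false - r (Fin.natAdd n j) true‖) / 2)) ≤ ((2 : ℝ) ^ n)⁻¹ := by
      calc _ ≤ (Real.sqrt 2 / 2) ^ n * (Real.sqrt 2 / 2) ^ n := by
            refine mul_le_mul ?_ ?_ (Finset.prod_nonneg fun _ _ => by positivity) (by positivity)
            · calc _ ≤ ∏ _i : Fin n, Real.sqrt 2 / 2 :=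
                    Finset.prod_le_prod (fun _ _ => by positivity) fun i _ => hhalf _
                _ = _ := by rw [Finset.prod_const, Finset.card_univ, Fintype.card_fin]
            · calc _ ≤ ∏ _j : Fin n, Real.sqrt 2 / 2 :=
                    Finset.prod_le_prod (fun _ _ => by positivity) fun j _ => hhalf _
                _ = _ := by rw [Finset.prod_const, Finset.card_univ, Fintype.card_fin]
        _ = ((2 : ℝ) ^ n)⁻¹ := by
            rw [← mul_pow, div_mul_div_comm, Real.mul_self_sqrt (by norm_num : (0:ℝ) ≤ 2),
              show (2 : ℝ) / (2 * 2) = 2⁻¹ by norm_num, inv_pow]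
    have hzz : ‖((∏ i : Fin n, (r (Fin.castAdd n i) false + r (Fin.castAdd n i) true) / 2) *
        ∏ j : Fin n, (r (Fin.natAdd n j) false + r (Fin.natAdd n j) true) / 2) * (2 : ℂ) ^ n‖ ≤ ((2 : ℝ) ^ n)⁻¹ := by
      rw [norm_mul, norm_mul, norm_pow, RCLike.norm_ofNat, norm_prod, norm_prod]
      calc _ ≤ (1 / 2 : ℝ) ^ n * (1 / 2) ^ n * (2 : ℝ) ^ n := by
            refine mul_le_mul_of_nonneg_right ?_ (by positivity)
            refine mul_le_mul ?_ ?_ (Finset.prod_nonneg fun _ _ => norm_nonneg _) (by positivity)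
            · calc _ ≤ ∏ _i : Fin n, (1 / 2 : ℝ) :=
                    Finset.prod_le_prod (fun _ _ => norm_nonneg _) fun i _ => hquart _
                _ = _ := by rw [Finset.prod_const, Finset.card_univ, Fintype.card_fin]
            · calc _ ≤ ∏ _j : Fin n, (1 / 2 : ℝ) :=
                    Finset.prod_le_prod (fun _ _ => norm_nonneg _) fun j _ => hquart _
                _ = _ := by rw [Finset.prod_const, Finset.card_univ, Fintype.card_fin]
        _ = ((2 : ℝ) ^ n)⁻¹ := by
            rw [one_div, inv_pow, mul_assoc, inv_mul_cancel₀ (by positivity), mul_one]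
    calc _ = ‖((∑ x : QReg n, (∏ i : Fin n, r (Fin.castAdd n i) (x i)) * ∏ j : Fin n, r (Fin.natAdd n j) (F x j)) -
              ((∏ i : Fin n, (r (Fin.castAdd n i) false + r (Fin.castAdd n i) true) / 2) *
                ∏ j : Fin n, (r (Fin.natAdd n j) false + r (Fin.natAdd n j) true) / 2) * (2 : ℂ) ^ n) +
            ((∏ i : Fin n, (r (Fin.castAdd n i) false + r (Fin.castAdd n i) true) / 2) *
              ∏ j : Fin n, (r (Fin.natAdd n j) false + r (Fin.natAdd n j) true) / 2) * (2 : ℂ) ^ n‖ := by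
          rw [sub_add_cancel]
      _ ≤ _ := (norm_add_le _ _).trans (add_le_add (h.trans (mul_le_mul_of_nonneg_right hmain (by positivity))) hzz)
  -- assemble
  have hcard : (Fintype.card (QReg n) : ℝ) = 2 ^ n := by simp [QReg]
  calc ‖∑ x : QReg n, ∑ x' : QReg n, (∏ i : Fin n, M (Fin.castAdd n i) (x i) (x' i)) *
          ∏ j : Fin n, M (Fin.natAdd n j) (F x j) (F x' j)‖
      = ‖(∑ x : QReg n, ((∑ x' : QReg n, (∏ i : Fin n, M (Fin.castAdd n i) (x i) (x' i)) *
            ∏ j : Fin n, M (Fin.natAdd n j) (F x j) (F x' j)) -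
            ((∏ i : Fin n, r (Fin.castAdd n i) (x i)) * ∏ j : Fin n, r (Fin.natAdd n j) (F x j)) * (2 : ℂ) ^ n)) +
          (∑ x : QReg n, (∏ i : Fin n, r (Fin.castAdd n i) (x i)) * ∏ j : Fin n, r (Fin.natAdd n j) (F x j)) *
            (2 : ℂ) ^ n‖ := by
        rw [Finset.sum_mul, ← Finset.sum_add_distrib]
        exact congrArg _ (Finset.sum_congr rfl fun x _ => by ring)
    _ ≤ (∑ x : QReg n, ‖(∑ x' : QReg n, (∏ i : Fin n, M (Fin.castAdd n i) (x i) (x' i)) *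
            ∏ j : Fin n, M (Fin.natAdd n j) (F x j) (F x' j)) -
            ((∏ i : Fin n, r (Fin.castAdd n i) (x i)) * ∏ j : Fin n, r (Fin.natAdd n j) (F x j)) * (2 : ℂ) ^ n‖) +
          ‖∑ x : QReg n, (∏ i : Fin n, r (Fin.castAdd n i) (x i)) * ∏ j : Fin n, r (Fin.natAdd n j) (F x j)‖ *
            (2 : ℝ) ^ n := by
        refine (norm_add_le _ _).trans (add_le_add (norm_sum_le _ _) ?_)
        rw [norm_mul, norm_pow, RCLike.norm_ofNat]
    _ ≤ (∑ _x : QReg n, (∏ i : Fin n, ((‖M (Fin.castAdd n i) false false + M (Fin.castAdd n i) false true‖ + ‖M (Fin.castAdd n i) false false - M (Fin.castAdd n i) false true‖) / 2)) *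
            (∏ j : Fin n, ((‖M (Fin.natAdd n j) false false + M (Fin.natAdd n j) false true‖ + ‖M (Fin.natAdd n j) false false - M (Fin.natAdd n j) false true‖) / 2)) * (2 * Real.sqrt 2 ^ n)) +
          (((2 : ℝ) ^ n)⁻¹ * (2 * Real.sqrt 2 ^ n) + ((2 : ℝ) ^ n)⁻¹) * (2 : ℝ) ^ n :=
        add_le_add (Finset.sum_le_sum fun x _ => hin x) (mul_le_mul_of_nonneg_right hzero (by positivity))
    _ = (2 : ℝ) ^ n * (2 * Real.sqrt 2 ^ n) * ∏ k : Fin (n + n), ((‖M k false false + M k false true‖ + ‖M k false false - M k false true‖) / 2) +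
          (2 * Real.sqrt 2 ^ n + 1) := by
        rw [Finset.sum_const, Finset.card_univ, nsmul_eq_mul, hcard, Fin.prod_univ_add]
        have h2n : (2 : ℝ) ^ n ≠ 0 := by positivity
        field_simp

/-- **Final arithmetic, H-like form**: `2^{-n}(2ⁿ·2√2ⁿ·P + 2√2ⁿ + 1) ≤ 2^{-n/16}` for `n ≥ 48` and
`P ≤ 2^{-5n/8}`. -/
theorem final_bound_hlike (n : ℕ) (hn : 48 ≤ n) (P : ℝ) (hP : P ≤ (2 : ℝ) ^ (-((5 : ℝ) / 8 * n))) :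
    ‖((Real.sqrt 2 : ℂ) ^ n)⁻¹‖ ^ 2 * ((2 : ℝ) ^ n * (2 * Real.sqrt 2 ^ n) * P + (2 * Real.sqrt 2 ^ n + 1)) ≤
      (2 : ℝ) ^ (-(1 / 16 * (n : ℝ))) := by
  have h2 : (0 : ℝ) < 2 := by norm_num
  have hn' : (48 : ℝ) ≤ n := by exact_mod_cast hn
  have hsq : Real.sqrt 2 ^ n = (2 : ℝ) ^ ((n : ℝ) / 2) := by
    rw [Real.sqrt_eq_rpow, ← Real.rpow_natCast, ← Real.rpow_mul h2.le]
    congr 1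
    ring
  have hnorm : ‖((Real.sqrt 2 : ℂ) ^ n)⁻¹‖ ^ 2 = (2 : ℝ) ^ (-(n : ℝ)) := by
    rw [norm_inv, norm_pow, Complex.norm_real, Real.norm_of_nonneg (Real.sqrt_nonneg _), inv_pow,
      ← pow_mul, pow_mul', Real.sq_sqrt h2.le, Real.rpow_neg h2.le, Real.rpow_natCast]
  have h2n : (2 : ℝ) ^ n = (2 : ℝ) ^ (n : ℝ) := (Real.rpow_natCast 2 n).symm
  rw [hnorm, hsq, h2n]
  -- 2^{-n}·2^{n}·2·2^{n/2}·P ≤ 2·2^{n/2 − 5n/8} = 2·2^{-n/8}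
  have hA : (2 : ℝ) ^ (-(n : ℝ)) * ((2 : ℝ) ^ (n : ℝ) * (2 * (2 : ℝ) ^ ((n : ℝ) / 2)) * P) ≤
      2 * (2 : ℝ) ^ (-(n : ℝ) / 8) := by
    have hP' : (2 : ℝ) ^ ((n : ℝ) / 2) * P ≤ (2 : ℝ) ^ (-(n : ℝ) / 8) := by
      calc (2 : ℝ) ^ ((n : ℝ) / 2) * P ≤ (2 : ℝ) ^ ((n : ℝ) / 2) * (2 : ℝ) ^ (-((5 : ℝ) / 8 * n)) := by gcongr
        _ = (2 : ℝ) ^ (-(n : ℝ) / 8) := by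
            rw [← Real.rpow_add h2]
            congr 1
            ring
    calc _ = ((2 : ℝ) ^ (-(n : ℝ)) * (2 : ℝ) ^ (n : ℝ)) * (2 * ((2 : ℝ) ^ ((n : ℝ) / 2) * P)) := by ring
      _ = 2 * ((2 : ℝ) ^ ((n : ℝ) / 2) * P) := by rw [← Real.rpow_add h2, neg_add_cancel, Real.rpow_zero, one_mul]
      _ ≤ 2 * (2 : ℝ) ^ (-(n : ℝ) / 8) := by linarith
  -- 2^{-n}(2·2^{n/2} + 1) ≤ 3·2^{-n/8}
  have hB : (2 : ℝ) ^ (-(n : ℝ)) * (2 * (2 : ℝ) ^ ((n : ℝ) / 2) + 1) ≤ 3 * (2 : ℝ) ^ (-(n : ℝ) / 8) := by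
    have e1 : (2 : ℝ) ^ (-(n : ℝ)) * (2 : ℝ) ^ ((n : ℝ) / 2) = (2 : ℝ) ^ (-(n : ℝ) / 2) := by
      rw [← Real.rpow_add h2]; congr 1; ring
    have i1 : (2 : ℝ) ^ (-(n : ℝ) / 2) ≤ (2 : ℝ) ^ (-(n : ℝ) / 8) :=
      Real.rpow_le_rpow_of_exponent_le one_le_two (by linarith)
    have i2 : (2 : ℝ) ^ (-(n : ℝ)) ≤ (2 : ℝ) ^ (-(n : ℝ) / 8) :=
      Real.rpow_le_rpow_of_exponent_le one_le_two (by linarith)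
    calc (2 : ℝ) ^ (-(n : ℝ)) * (2 * (2 : ℝ) ^ ((n : ℝ) / 2) + 1)
        = 2 * ((2 : ℝ) ^ (-(n : ℝ)) * (2 : ℝ) ^ ((n : ℝ) / 2)) + (2 : ℝ) ^ (-(n : ℝ)) := by ring
      _ = 2 * (2 : ℝ) ^ (-(n : ℝ) / 2) + (2 : ℝ) ^ (-(n : ℝ)) := by rw [e1]
      _ ≤ 2 * (2 : ℝ) ^ (-(n : ℝ) / 8) + (2 : ℝ) ^ (-(n : ℝ) / 8) := by linarith
      _ = 3 * (2 : ℝ) ^ (-(n : ℝ) / 8) := by ring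
  -- 5·2^{-n/8} ≤ 8·2^{-n/8} = 2^{3 − n/8} ≤ 2^{-n/16}
  have hC : 5 * (2 : ℝ) ^ (-(n : ℝ) / 8) ≤ (2 : ℝ) ^ (-(1 / 16 * (n : ℝ))) := by
    have i0 : (0 : ℝ) ≤ (2 : ℝ) ^ (-(n : ℝ) / 8) := by positivity
    calc 5 * (2 : ℝ) ^ (-(n : ℝ) / 8) ≤ (2 : ℝ) ^ (3 : ℝ) * (2 : ℝ) ^ (-(n : ℝ) / 8) := by
          rw [show (2 : ℝ) ^ (3 : ℝ) = 8 by norm_num]; linarith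
      _ = (2 : ℝ) ^ (3 + -(n : ℝ) / 8) := by rw [Real.rpow_add h2]
      _ ≤ (2 : ℝ) ^ (-(1 / 16 * (n : ℝ))) := Real.rpow_le_rpow_of_exponent_le one_le_two (by linarith)
  calc (2 : ℝ) ^ (-(n : ℝ)) * ((2 : ℝ) ^ (n : ℝ) * (2 * (2 : ℝ) ^ ((n : ℝ) / 2)) * P + (2 * (2 : ℝ) ^ ((n : ℝ) / 2) + 1))
      = (2 : ℝ) ^ (-(n : ℝ)) * ((2 : ℝ) ^ (n : ℝ) * (2 * (2 : ℝ) ^ ((n : ℝ) / 2)) * P) +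
          (2 : ℝ) ^ (-(n : ℝ)) * (2 * (2 : ℝ) ^ ((n : ℝ) / 2) + 1) := by ring
    _ ≤ 2 * (2 : ℝ) ^ (-(n : ℝ) / 8) + 3 * (2 : ℝ) ^ (-(n : ℝ) / 8) := add_le_add hA hB
    _ = 5 * (2 : ℝ) ^ (-(n : ℝ) / 8) := by ring
    _ ≤ _ := hC

end HLike

/-- **Stub K4c · `stub_hlikeFlat`** of line `Sketch` (registered on stmt-QuantumAdvantage-0242): flatness of
the normalised cube graph state against every locally rotated Pauli string whose row-Fourier mass
`∏_{k<2n} ½(‖M_k(0,0)+M_k(0,1)‖ + ‖M_k(0,0)−M_k(0,1)‖)` is at most `2^{-5n/8}` (Hadamard-like tests: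
polar ≈ 45° AND azimuth near the X–Z plane on most of the 2n sites) — any field of order `2ⁿ`, any additive
`e`, arbitrary one-qubit unitaries; `δ = 1/16`, `n₀ = 48`. -/
theorem stub_hlikeFlat :
    ∃ δ : ℝ, 0 < δ ∧ ∃ n₀ : ℕ, ∀ n ≥ n₀, ∀ (K : Type) [Field K] [Fintype K], Fintype.card K = 2 ^ n →
      ∀ e : K ≃+ (Fin n → ZMod 2),
      ∀ u : Fin (n + n) → Matrix Bool Bool ℂ, (∀ i, u i ∈ Matrix.unitaryGroup Bool ℂ) →
        ∀ S : Fin (n + n) → Pauli, S ≠ (fun _ => Pauli.I) →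
          (∏ k : Fin (n + n), ((‖(u k * (S k).mat * star (u k)) false false + (u k * (S k).mat * star (u k)) false true‖ +
              ‖(u k * (S k).mat * star (u k)) false false - (u k * (S k).mat * star (u k)) false true‖) / 2) ≤
            (2 : ℝ) ^ (-((5 : ℝ) / 8 * n))) →
          ‖star (fun w : QReg (n + n) =>
                if (fun j : Fin n => w (Fin.natAdd n j)) =
                    (fun j : Fin n => decide (e ((e.symm (fun i : Fin n => if w (Fin.castAdd n i) then 1 else 0)) ^ 3) j = 1))
                then ((Real.sqrt 2 ^ n)⁻¹ : ℂ) else 0) ⬝ᵥ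
              (tensorAll (fun i => u i * (S i).mat * star (u i))).mulVec
                (fun w : QReg (n + n) =>
                  if (fun j : Fin n => w (Fin.natAdd n j)) =
                      (fun j : Fin n => decide (e ((e.symm (fun i : Fin n => if w (Fin.castAdd n i) then 1 else 0)) ^ 3) j = 1))
                  then ((Real.sqrt 2 ^ n)⁻¹ : ℂ) else 0)‖
            ≤ (2 : ℝ) ^ (-(δ * (n : ℝ))) := by
  refine ⟨1 / 16, by norm_num, 48, ?_⟩
  intro n hn K _ _ hK e u hu S _ hprod
  refine le_trans (HLike.norm_graph_dot_le_hlike hK e u hu S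
    (fun x j => decide (e ((e.symm fun i : Fin n => if x i then 1 else 0) ^ 3) j = 1))
    (fun x j => rfl) _) ?_
  exact HLike.final_bound_hlike n hn _ hprod

end Summit.QuantumAdvantage.QuantumAdvantage.Theorems.SymplecticPurity

end
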